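import Mathlib

/-!
# The root-edge chord inequality of the gate functional FAILS — a kernel certificate
(blind cell PercRepro2, seat night-1, 2026-08-23)

Setting (row 2′CON-W / (CC-T⁻), `CCTLin.CCTMinus`): a finite graph `H`, root `s`, avoided set `T`,
markers `a, b`, a free edge `e = {u, w}` absent from `H`; `S = C(s)`, `K = C(T)`, `R_T = {S ∩ T = ∅}`,
`x = 1[a ∈ S]`, `y = 1[b ∈ S]`, the gate `E = {s ↛ T in H + e} ⊆ R_T`, and the GATE FUNCTIONAL
`Φ(H) := E[(x − x̄)(y − ȳ)·1_E | R_T]` with `x̄ = E[x | R_T]` (so `(CC-T⁻)` is `Φ ≥ 0`).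

For a root edge `e' = {s, z}` write `H/e'` for the instance with `e'` open (z merged into `s`) and
`H − e'` for `e'` closed, `p' = P(e' open | R_T)`.  Exact identity (any edge, any instance):
`Φ(H) = p'·Φ(H/e') + (1 − p')·Φ(H − e') + p'(1 − p')·Q`,
`Q = ΔxΔy[(1−p')r₁ + p'r₀] + Δx[Cov₁(y,ρ) − Cov₀(y,ρ)] + Δy[Cov₁(x,ρ) − Cov₀(x,ρ)]`
(`ρ = P(E | S)`, `Δx = x̄₁ − x̄₀`, subscripts = the two minors).  The increments of the re-centred
potential `Φ_h := E[(x − m^h_X)(y − m^h_Y)1_E | h]` along any exploration of `S` are exactly these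
chord defects, so «every conditional increment ≥ 0» ⟺ «`Φ(H) ≥ p'Φ(H/e') + (1−p')Φ(H − e')` at every
queried root edge».  This file checks in the kernel that the chord inequality FAILS:

on the graph `c7_00090` (vertices `0..6`, edges `{0,5}, {1,4}, {2,3}, {2,6}, {3,6}, {4,5}, {4,6},
{5,6}` with weights `1/8, 1/8, 7/8, 1/8, 1/8, 1/8, 1/8, 7/8`), `s = 1`, `T = {3}`, `a = 0`, `b = 6`,
`u = 2`, `w = 5` (free edge `{2,5}`), at the root edge `e' = {1,4}` — the ONLY edge at `s`, so every
root-cluster exploration must query it first — with masses in units of `8^{-8}`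

  `e'` open:   `M₁ = 1995000`, `E[x] = 45878`, `E[y] = 360696`, `E[1_E] = 1678992`,
               `E[x1_E] = 6377`, `E[y1_E] = 69832`, `E[xy1_E] = 5936`;
  `e'` closed: `M₀ = 14680064` (`s` isolated: `x = y = 0`, `1_E = 1`),

one gets `Φ(H) = 83340134547751/211216788163260872 > 0` (the row holds), `Φ(H − e') = 0`,
`Φ(H/e') = 32310611039/6345703125000`, `p' = 35625/297769`, and the chord defect
`Φ(H) − p'Φ(H/e') − (1−p')Φ(H − e') = −126155580982337241088/587859224868450669140625 < 0`.

Hence NO root-cluster exploration of this instance has node-wise nonnegative re-centred increments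
(the exploration-martingale of `(CC-T⁻)` has no local certificate at this instance; the game search
over ALL adaptive edge orders, two implementations, also finds none).  The 14 masses are established
by `decide` (kernel evaluation, standard axioms only); the inequalities follow by `norm_num`.
Re-derived exactly by two independent evaluators (session work/gate.py, work/fastgate.py).
-/

namespace Summit.Ventures.PercRepro2.GateChord

/-- An undirected edge `{u, v}`, open with probability `w / 8`. -/
structure Edge where
  u : Nat
  v : Nat
  w : Nat

/-- The eight edges of `c7_00090` (vertices `0..6`) with the witness weights. -/
def edge : Nat → Edge
  | 0 => ⟨0, 5, 1⟩   -- {0,5}, p = 1/8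
  | 1 => ⟨1, 4, 1⟩   -- {1,4}, p = 1/8   (the root edge e')
  | 2 => ⟨2, 3, 7⟩   -- {2,3}, p = 7/8
  | 3 => ⟨2, 6, 1⟩   -- {2,6}, p = 1/8
  | 4 => ⟨3, 6, 1⟩   -- {3,6}, p = 1/8
  | 5 => ⟨4, 5, 1⟩   -- {4,5}, p = 1/8
  | 6 => ⟨4, 6, 1⟩   -- {4,6}, p = 1/8
  | _ => ⟨5, 6, 7⟩   -- {5,6}, p = 7/8

/-- The root `s = 1`. -/
def s : Nat := 1
/-- The avoided vertex `t = 3` (`T = {3}`). -/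
def t : Nat := 3
/-- The marker `a = 0`. -/
def a : Nat := 0
/-- The marker `b = 6`. -/
def b : Nat := 6
/-- The free edge `e = {u, w} = {2, 5}`, absent from `H`. -/
def u : Nat := 2
/-- The other endpoint of the free edge. -/
def w : Nat := 5

/-- Edge `i` is open in the configuration `c ∈ [0, 2^8)` iff bit `i` of `c` is set. -/
def isOpen (c i : Nat) : Bool := c.testBit i

/-- Product Bernoulli weight of the configuration `c`, in units of `8^{-8}`. -/
def wt (c : Nat) : Nat :=
  (List.range 8).foldl (fun acc i => acc * (if isOpen c i then (edge i).w else 8 - (edge i).w)) 1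

/-- Vertex sets are bitmasks over `0..6`; `mem S x` is `x ∈ S`. -/
def mem (S x : Nat) : Bool := S.testBit x

/-- One expansion step of a vertex set along the open edges of `H` (undirected). -/
def step (c S : Nat) : Nat :=
  (List.range 8).foldl (fun S i =>
    let e := edge i
    if isOpen c i then
      if mem S e.u || mem S e.v then S ||| (1 <<< e.u) ||| (1 <<< e.v) else S
    else S) S

/-- The same step in `H + e`: the free edge `{u, w}` is always open. -/
def stepPlus (c S : Nat) : Nat :=
  let S' := step c S
  if mem S' u || mem S' w then S' ||| (1 <<< u) ||| (1 <<< w) else S'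

/-- `n`-fold iteration. -/
def iter (f : Nat → Nat) : Nat → Nat → Nat
  | 0, S => S
  | n + 1, S => iter f n (f S)

/-- `C(v)` in `H`: the open cluster of `v` (seven steps suffice on seven vertices). -/
def reach (c v : Nat) : Nat := iter (step c) 7 (1 <<< v)
/-- The open cluster of `v` in `H + e`. -/
def reachPlus (c v : Nat) : Nat := iter (stepPlus c) 7 (1 <<< v)

/-- `R_T = {s ↛ t in H}`. -/
def RT (c : Nat) : Bool := !(mem (reach c s) t)
/-- The gate `E = {s ↛ t in H + e}` (`⊆ R_T`). -/
def E (c : Nat) : Bool := !(mem (reachPlus c s) t)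
/-- `x = 1[a ∈ C(s)]`. -/
def x (c : Nat) : Bool := mem (reach c s) a
/-- `y = 1[b ∈ C(s)]`. -/
def y (c : Nat) : Bool := mem (reach c s) b
/-- The bit of the root edge `e' = {1, 4}` (edge index `1`). -/
def open1 (c : Nat) : Bool := isOpen c 1

/-- `8^8 · P(R_T ∩ {e' open} ∩ F)` for a predicate `F`. -/
def mass1 (F : Nat → Bool) : Nat :=
  (List.range 256).foldl (fun acc c => if RT c && open1 c && F c then acc + wt c else acc) 0
/-- `8^8 · P(R_T ∩ {e' closed} ∩ F)`. -/
def mass0 (F : Nat → Bool) : Nat :=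
  (List.range 256).foldl (fun acc c => if RT c && !open1 c && F c then acc + wt c else acc) 0

/-- Total mass `8^8` (sanity: the weights sum to one). -/
theorem total_mass : (List.range 256).foldl (fun acc c => acc + wt c) 0 = 8 ^ 8 := by decide +kernel

/-- The gate is a sub-event of `R_T` (sanity). -/
theorem gate_subset : ∀ c, c < 256 → E c = true → RT c = true := by decide +kernel

/-! ### The fourteen masses (kernel evaluation). -/

/-- `8^8 · P(R_T, e' open) = 1995000`. -/
theorem M1_eq : mass1 (fun _ => true) = 1995000 := by decide +kernel
/-- `8^8 · E[x; R_T, e' open] = 45878`. -/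
theorem Mx1_eq : mass1 x = 45878 := by decide +kernel
/-- `8^8 · E[y; R_T, e' open] = 360696`. -/
theorem My1_eq : mass1 y = 360696 := by decide +kernel
/-- `8^8 · P(E, e' open) = 1678992`. -/
theorem Mr1_eq : mass1 E = 1678992 := by decide +kernel
/-- `8^8 · E[x; E, e' open] = 6377`. -/
theorem Mxr1_eq : mass1 (fun c => x c && E c) = 6377 := by decide +kernel
/-- `8^8 · E[y; E, e' open] = 69832`. -/
theorem Myr1_eq : mass1 (fun c => y c && E c) = 69832 := by decide +kernel
/-- `8^8 · E[xy; E, e' open] = 5936`. -/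
theorem Mxyr1_eq : mass1 (fun c => x c && y c && E c) = 5936 := by decide +kernel
/-- `8^8 · P(R_T, e' closed) = 14680064 = 7·8^7` (`s` isolated). -/
theorem M0_eq : mass0 (fun _ => true) = 14680064 := by decide +kernel
/-- `E[x; R_T, e' closed] = 0`. -/
theorem Mx0_eq : mass0 x = 0 := by decide +kernel
/-- `E[y; R_T, e' closed] = 0`. -/
theorem My0_eq : mass0 y = 0 := by decide +kernel
/-- `8^8 · P(E, e' closed) = 14680064` (the gate is sure when `s` is isolated). -/
theorem Mr0_eq : mass0 E = 14680064 := by decide +kernel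
/-- `E[x; E, e' closed] = 0`. -/
theorem Mxr0_eq : mass0 (fun c => x c && E c) = 0 := by decide +kernel
/-- `E[y; E, e' closed] = 0`. -/
theorem Myr0_eq : mass0 (fun c => y c && E c) = 0 := by decide +kernel
/-- `E[xy; E, e' closed] = 0`. -/
theorem Mxyr0_eq : mass0 (fun c => x c && y c && E c) = 0 := by decide +kernel

/-- The gate functional from the masses `(M, E[x], E[y], E[1_E], E[x1_E], E[y1_E], E[xy1_E])`
(all in the same units): `Φ = E[xy1_E]/M − x̄·E[y1_E]/M − ȳ·E[x1_E]/M + x̄ȳ·E[1_E]/M`. -/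
def Phi (M Mx My Mr Mxr Myr Mxyr : ℚ) : ℚ :=
  Mxyr / M - (Mx / M) * (Myr / M) - (My / M) * (Mxr / M) + (Mx / M) * (My / M) * (Mr / M)

/-- `Φ(H)` (the `(CC-T⁻)` slack divided by `P(R_T)`) on the witness, from the masses. -/
noncomputable def PhiH : ℚ :=
  Phi (mass1 (fun _ => true) + mass0 (fun _ => true)) (mass1 x + mass0 x) (mass1 y + mass0 y)
    (mass1 E + mass0 E) (mass1 (fun c => x c && E c) + mass0 (fun c => x c && E c))
    (mass1 (fun c => y c && E c) + mass0 (fun c => y c && E c))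
    (mass1 (fun c => x c && y c && E c) + mass0 (fun c => x c && y c && E c))
/-- `Φ(H/e')` (the minor with `e'` open). -/
noncomputable def PhiOpen : ℚ :=
  Phi (mass1 (fun _ => true)) (mass1 x) (mass1 y) (mass1 E) (mass1 (fun c => x c && E c))
    (mass1 (fun c => y c && E c)) (mass1 (fun c => x c && y c && E c))
/-- `Φ(H − e')` (the minor with `e'` closed). -/
noncomputable def PhiClosed : ℚ :=
  Phi (mass0 (fun _ => true)) (mass0 x) (mass0 y) (mass0 E) (mass0 (fun c => x c && E c))
    (mass0 (fun c => y c && E c)) (mass0 (fun c => x c && y c && E c))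
/-- `p' = P(e' open | R_T)`. -/
noncomputable def pOpen : ℚ :=
  (mass1 (fun _ => true) : ℚ) / (mass1 (fun _ => true) + mass0 (fun _ => true))

/-- The row `(CC-T⁻)` holds on the witness: `Φ(H) = 83340134547751/211216788163260872 > 0`. -/
theorem PhiH_eq : PhiH = 83340134547751 / 211216788163260872 := by
  unfold PhiH Phi
  rw [M1_eq, Mx1_eq, My1_eq, Mr1_eq, Mxr1_eq, Myr1_eq, Mxyr1_eq,
    M0_eq, Mx0_eq, My0_eq, Mr0_eq, Mxr0_eq, Myr0_eq, Mxyr0_eq]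
  norm_num

/-- `Φ(H) > 0`. -/
theorem PhiH_pos : 0 < PhiH := by rw [PhiH_eq]; norm_num

/-- `Φ(H/e') = 32310611039/6345703125000`. -/
theorem PhiOpen_eq : PhiOpen = 32310611039 / 6345703125000 := by
  unfold PhiOpen Phi
  rw [M1_eq, Mx1_eq, My1_eq, Mr1_eq, Mxr1_eq, Myr1_eq, Mxyr1_eq]
  norm_num

/-- `Φ(H − e') = 0` (`s` is isolated when `e'` is closed). -/
theorem PhiClosed_eq : PhiClosed = 0 := by
  unfold PhiClosed Phi
  rw [M0_eq, Mx0_eq, My0_eq, Mr0_eq, Mxr0_eq, Myr0_eq, Mxyr0_eq]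
  norm_num

/-- `p' = 35625/297769`. -/
theorem pOpen_eq : pOpen = 35625 / 297769 := by
  unfold pOpen; rw [M1_eq, M0_eq]; norm_num

/-- **The chord defect is negative**: `Φ(H) − p'Φ(H/e') − (1−p')Φ(H − e') =
−126155580982337241088/587859224868450669140625 < 0`. -/
theorem chord_defect_eq :
    PhiH - pOpen * PhiOpen - (1 - pOpen) * PhiClosed =
      -126155580982337241088 / 587859224868450669140625 := by
  rw [PhiH_eq, PhiOpen_eq, PhiClosed_eq, pOpen_eq]; norm_num

/-- The root-edge chord inequality `Φ(H) ≥ p'Φ(H/e') + (1−p')Φ(H − e')` FAILS at the only edge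
incident to the root: no root-cluster exploration of this instance is node-wise nonnegative. -/
theorem chord_fails : PhiH < pOpen * PhiOpen + (1 - pOpen) * PhiClosed := by
  rw [PhiH_eq, PhiOpen_eq, PhiClosed_eq, pOpen_eq]; norm_num

end Summit.Ventures.PercRepro2.GateChord
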